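import Mathlib
import HarnessLib
import Summits.HubbardSuperconductivity.HubbardSuperconductivity.Theorems.KLProgrammeKLRegimeSplitFieldStrengthSectorStatic
import Summits.HubbardSuperconductivity.HubbardSuperconductivity.Theorems.KLProgrammeKLRegimeEngineV8TwoLegSectorMomentsDoor
import Summits.HubbardSuperconductivity.HubbardSuperconductivity.Theorems.KLProgrammeKLRegimeSplitSlotsV17F
import Summits.HubbardSuperconductivity.HubbardSuperconductivity.Theorems.KLProgrammeKLRegimeSplitLegCount
import Summits.HubbardSuperconductivity.HubbardSuperconductivity.Theorems.KLProgrammeKLRegimeSplitThermalLayerExt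

/-!
# Route `KLProgramme` — ENGINE child gen 8 (stmt-HubbardSuperconductivity-20437 `KLRegimeEngineV17F2`), stub (b) conj. 4 / class #7: the SECTOR-PINNED,
# PER-INCREMENT TWO-LEG MOMENTS ATOM `TwoLegSectorFlowMomentsAt` (the (N)/(T″-SP)/(T‴-H) text of plan g20 (R72)), v3 — static parts projected out —
# with BOTH consumer rows closed and the supplier door from the tower's carrier
# (cell gate-hubbard-kl, seat hubbard-kl-k3c2-p3 g8/g9; memos W3-CURRENCY.md §4, W3-SMEAR.md; typed so that the 08-28 branch word is executable, not designed)

WHAT.  The successor of the grid atom #27 `TwoLegGridFlowMomentsAt[C]` in the currency in which the two-leg power-counting improvement of the curved Fermi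
curve is visible (BGM 2006 §3 (3.6) `sup_{ω̄}`): for the flow frame `K_n = klFlowFrameU L M β U μ n` and every scale `j < n`, the two-leg kernel of the
INCREMENT `Δ_j = 𝒱^{(j+1)}[K_n] − 𝒱^{(j)}[K_n]` (`klEffectiveAction`, the one-shot cutoff ladder at the fixed frame), CORRECTED by supplier-chosen pieces that the
read-out cannot see (`S_j` with symmetric `Im Σ̂_{S_j}(±ω₀,k⃗)` — time-local pieces; `S′_j` with `Σ̂_{S′_j}(ν,·)` momentum-independent — on-site pieces),
SECTORISED with the anisotropic family of scale `s_n(j) := min (j+1) (n−3)` (`twoLegSectorScale`), leg `0` PINNED at `(x₀, ω)` INCLUDING its sector, leg `1`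
summed over positions and ALL labels, has
  (time)  `ε_x Σ_{x : x 0 = x₀} Σ_{ω′} ε_x·circDist_{2M}(t₀,t₁)·‖W_{2,((ω,σ),+),((ω′,σ),−)}(Δ_j − S_j)(x)‖ ≤ bt j · U²`,
  (space) `ε_x Σ_{x : x 0 = x₀} Σ_{ω′} (|Δx̃₀| + |Δx̃₁|)·‖W_{2,((ω,σ),+),((ω′,σ),−)}(Δ_j − S′_j)(x)‖ ≤ bs j · U²`
for per-scale budgets `bt, bs ≥ 0` with `Σ_{j<n} bt j ≤ Zt`, `Σ_{j<n} bs j ≤ Zs`.  WHY THE CORRECTIONS (v3, memo W3-SMEAR): the scale-`s` multipliers depend on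
`k₀`, so the sectorised kernel of a STATIC first-order piece (the on-site tadpole increment `U·n_j(K_n)`) is smeared over `|t₀−t₁| ≲ Λ_s⁻¹` and would charge
`bt j` by `≈ mass·Λ_s⁻¹/U²` with no two-leg gain, although it contributes exactly `0` to `z − 1`; `S = S′ = 0` recovers v2′, so v3 is a pure weakening.

* §1 `twoLegSectorScale`; **`TwoLegSectorIncrementAt L M bt bs β U μ K s j`**; **`TwoLegSectorFlowMomentsAt L M Zt Zs β U μ n`** := `∃ bt bs ≥ 0` with the two
  budget lines and `∀ j < n, TwoLegSectorIncrementAt … (bt j) (bs j) … (K_n) (s_n j) j`; monotonicity;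
* §2 geometry of the read-out point: `sqrt_le_klScale_twoLegSectorScale` — `0 < β`, `3 ≤ n`, `π/β ≤ 4Λ_n`, `|e_K(k⃗)| ≤ Λ_n` ⇒ `√((π/β)² + e_K(k⃗)²) ≤ Λ_{s_n(j)+1}`;
  the regime gives `π/β ≤ 4Λ_n` at EVERY engine scale `n ≤ n_β + 1` (`klte_pi_div_le_four_mul_klScale`, `…SplitThermalLayerExt`);
* §3 **TIME ROW, CLOSED**: `abs_klFieldStrength_sub_one_le_of_twoLegSectorFlowMomentsAt` — atom ∧ `3 ≤ n` ∧ `π/β ≤ 4Λ_n` ∧ `k⃗ ∈ klShell L μ (K_n) n` ⇒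
  **`|z_n(K_n)(k⃗) − 1| ≤ |z_0(K_n)(k⃗) − 1| + 4·Zt·U²`** (`…FieldStrengthSectorStatic` + `#A ≤ 2`);
* §4 **SPACE ROW AS A SHELL-LIPSCHITZ BOUND, CLOSED**: `norm_klSelfEnergy_sub_le_of_twoLegSectorFlowMomentsAt` — `p⃗, p⃗′ ∈ klShell … n` ⇒
  **`‖Σ_n(ω₀,p⃗) − Σ_n(ω₀,p⃗′)‖ ≤ ‖Σ_0(ω₀,p⃗) − Σ_0(ω₀,p⃗′)‖ + 8·dist(p⃗,p⃗′)·Zs·U²`** (union label set, `#A ≤ 4`); whether B2′ reads this local form is (Q-e-LIP);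
* §5 **SUPPLIER DOOR**: `twoLegSectorIncrementAt_of_klWtPinnedSumAt` — bounds `klWtPinnedSumAt L M β μ K s r 2 (Δ_j − S) 0 (x₀,((ω,σ),+)) ≤ b·U²` and
  `… (Δ_j − S′) … ≤ b′·U²` in the tower's own carrier (family `s`, any rate `r`) give `TwoLegSectorIncrementAt L M (Λ_r⁻¹b) (2Λ_r⁻¹b′) β U μ K s j`
  (`…TwoLegSectorMomentsDoor`).
Definitions with bodies + proofs; nothing about the model is asserted; nothing asserts superconductivity.
References: BGM 2006 §2.4 (2.36), §2.5 (2.45), Thm 2.1 (2.77), §3 (3.5)–(3.6) [cite: BenfattoGiulianiMastropietro2006].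
-/

noncomputable section

namespace Summit.HubbardSuperconductivity.HubbardSuperconductivity.Theorems.KLRegimeSplit

set_option linter.dupNamespace false -- summit = problem name (single-conjunct summit), D-0017

open Real Finset Literature.MathematicalPhysics.QuantumLattice Literature.Probability.LatticeModels GrassmannAlgebra
open Summit.HubbardSuperconductivity.HubbardSuperconductivity.Theorems.KLProgrammeLegKernels
open Summit.HubbardSuperconductivity.HubbardSuperconductivity.Theorems.TwoLegFourier

/-! ## §1 The atom -/

/-- **The sectorisation scale of the `j`-th increment read at depth `n`**: the increment's own scale `j+1`, coarsened to `n − 3` for the last three increments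
(so that the family's ball plateau `{√(k₀²+e²) ≤ Λ_{s+1}}` ⊇ `{… ≤ Λ_{n−2} = 16Λ_n}` contains the scale-`n` read-out points `(±π/β, k⃗ ∈ S_n)` whenever
`π/β ≤ 4Λ_n` — true at EVERY regime scale `n ≤ n_β + 1`, `klte_pi_div_le_four_mul_klScale`). -/
def twoLegSectorScale (n j : ℕ) : ℕ := min (j + 1) (n - 3)

/-- `s_n(j) + 1 ≤ n − 2` for `3 ≤ n`. -/
theorem twoLegSectorScale_succ_le {n j : ℕ} (hn : 3 ≤ n) : twoLegSectorScale n j + 1 ≤ n - 2 := by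
  unfold twoLegSectorScale; omega

section Model

variable (L M : ℕ) [NeZero L] [NeZero M]

/-- **`TwoLegSectorIncrementAt L M bt bs β U μ K s j`** (v3) — there are Grassmann corrections `S` (symmetric `Im Σ̂_S((±ω₀, k⃗), σ)` for all `k⃗, σ`: invisible to
the field strength) and `S′` (`Σ̂_{S′}((ν, p⃗), σ)` independent of `p⃗`: invisible to self-energy differences) such that the two-leg kernel of
`𝒱^{(j+1)}[K] − 𝒱^{(j)}[K] − S` (resp. `− S′`), sectorised with the scale-`s` anisotropic family, leg `0` pinned at `(x₀, ω)` (position AND sector), leg `1` summed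
over positions and all labels, has sector-pinned temporal first moment `≤ bt·U²` (resp. spatial first moment `≤ bs·U²`), for both spins, every `ω`, every `x₀`.
`S = S′ = 0` is the uncorrected (v2′) clause. -/
def TwoLegSectorIncrementAt (bt bs : ℝ) (β U μ : ℝ) (K : TrigPolyC4v) (s j : ℕ) : Prop :=
  (∃ S : HubbardGrassmann L M,
    (∀ (k : TorusSite 2 L) (σ : Fin 2), (selfEnergy L M β S (omega0 M, k) σ).im = (selfEnergy L M β S ((omega0 M).rev, k) σ).im) ∧
    ∀ (σ : Fin 2) (ω : Fin (sectorCount s)) (x₀ : SpaceTimeIdx L M), imagTimeWeight β M *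
      ∑ x ∈ (univ : Finset (Fin 2 → SpaceTimeIdx L M)).filter (fun x => x 0 = x₀), ∑ ω' : Fin (sectorCount s),
        imagTimeWeight β M * (circDist (2 * M) (x 0).1.val (x 1).1.val : ℝ) *
          ‖sectorisedKernel L M β (klAnisoFamily L M β μ K klE0 s)
              (klEffectiveAction L M β U μ K klE0 (j + 1) - klEffectiveAction L M β U μ K klE0 j - S) 2
              (![((ω, σ), 0), ((ω', σ), 1)] : Fin 2 → SectorLeg (sectorCount s)) x‖ ≤ bt * U ^ 2) ∧
  (∃ S' : HubbardGrassmann L M,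
    (∀ (ν : MatsubaraIdx M) (σ : Fin 2) (p p' : TorusSite 2 L), selfEnergy L M β S' (ν, p) σ = selfEnergy L M β S' (ν, p') σ) ∧
    ∀ (σ : Fin 2) (ω : Fin (sectorCount s)) (x₀ : SpaceTimeIdx L M), imagTimeWeight β M *
      ∑ x ∈ (univ : Finset (Fin 2 → SpaceTimeIdx L M)).filter (fun x => x 0 = x₀), ∑ ω' : Fin (sectorCount s),
        (|((((x 0).2 - (x 1).2) 0).valMinAbs : ℝ)| + |((((x 0).2 - (x 1).2) 1).valMinAbs : ℝ)|) *
          ‖sectorisedKernel L M β (klAnisoFamily L M β μ K klE0 s)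
              (klEffectiveAction L M β U μ K klE0 (j + 1) - klEffectiveAction L M β U μ K klE0 j - S') 2
              (![((ω, σ), 0), ((ω', σ), 1)] : Fin 2 → SectorLeg (sectorCount s)) x‖ ≤ bs * U ^ 2)

/-- **`TwoLegSectorFlowMomentsAt L M Zt Zs β U μ n`** — THE SECTOR-PINNED PER-INCREMENT CLASS-#7 ATOM at the flow frame `K_n`: per-scale budgets `bt, bs ≥ 0`
with `Σ_{j<n} bt j ≤ Zt`, `Σ_{j<n} bs j ≤ Zs`, and `TwoLegSectorIncrementAt … (bt j) (bs j) … K_n (s_n j) j` for every `j < n`. -/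
def TwoLegSectorFlowMomentsAt (Zt Zs : ℝ) (β U μ : ℝ) (n : ℕ) : Prop :=
  ∃ bt bs : ℕ → ℝ, (∀ j < n, 0 ≤ bt j ∧ 0 ≤ bs j) ∧ (∑ j ∈ range n, bt j ≤ Zt) ∧ (∑ j ∈ range n, bs j ≤ Zs) ∧
    ∀ j < n, TwoLegSectorIncrementAt L M (bt j) (bs j) β U μ (klFlowFrameU L M β U μ n) (twoLegSectorScale n j) j

variable {L M}

/-- Budget monotonicity of the increment atom (`U²`-scaled budgets grow with `bt, bs`). -/
theorem TwoLegSectorIncrementAt.mono {bt bs bt' bs' β U μ : ℝ} {K : TrigPolyC4v} {s j : ℕ} (h : TwoLegSectorIncrementAt L M bt bs β U μ K s j)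
    (ht : bt ≤ bt') (hs : bs ≤ bs') : TwoLegSectorIncrementAt L M bt' bs' β U μ K s j := by
  obtain ⟨⟨S, hS, hT⟩, ⟨S', hS', hX⟩⟩ := h
  exact ⟨⟨S, hS, fun σ ω x₀ => (hT σ ω x₀).trans (mul_le_mul_of_nonneg_right ht (sq_nonneg U))⟩,
    ⟨S', hS', fun σ ω x₀ => (hX σ ω x₀).trans (mul_le_mul_of_nonneg_right hs (sq_nonneg U))⟩⟩

/-- **The uncorrected (v2′) clauses imply the atom** (`S = S′ = 0`): v3 is a pure weakening of v2′. -/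
theorem TwoLegSectorIncrementAt.of_uncorrected {bt bs β U μ : ℝ} {K : TrigPolyC4v} {s j : ℕ}
    (hT : ∀ (σ : Fin 2) (ω : Fin (sectorCount s)) (x₀ : SpaceTimeIdx L M), imagTimeWeight β M *
      ∑ x ∈ (univ : Finset (Fin 2 → SpaceTimeIdx L M)).filter (fun x => x 0 = x₀), ∑ ω' : Fin (sectorCount s),
        imagTimeWeight β M * (circDist (2 * M) (x 0).1.val (x 1).1.val : ℝ) *
          ‖sectorisedKernel L M β (klAnisoFamily L M β μ K klE0 s)
              (klEffectiveAction L M β U μ K klE0 (j + 1) - klEffectiveAction L M β U μ K klE0 j) 2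
              (![((ω, σ), 0), ((ω', σ), 1)] : Fin 2 → SectorLeg (sectorCount s)) x‖ ≤ bt * U ^ 2)
    (hX : ∀ (σ : Fin 2) (ω : Fin (sectorCount s)) (x₀ : SpaceTimeIdx L M), imagTimeWeight β M *
      ∑ x ∈ (univ : Finset (Fin 2 → SpaceTimeIdx L M)).filter (fun x => x 0 = x₀), ∑ ω' : Fin (sectorCount s),
        (|((((x 0).2 - (x 1).2) 0).valMinAbs : ℝ)| + |((((x 0).2 - (x 1).2) 1).valMinAbs : ℝ)|) *
          ‖sectorisedKernel L M β (klAnisoFamily L M β μ K klE0 s)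
              (klEffectiveAction L M β U μ K klE0 (j + 1) - klEffectiveAction L M β U μ K klE0 j) 2
              (![((ω, σ), 0), ((ω', σ), 1)] : Fin 2 → SectorLeg (sectorCount s)) x‖ ≤ bs * U ^ 2) :
    TwoLegSectorIncrementAt L M bt bs β U μ K s j :=
  ⟨⟨0, fun _ _ => by simp only [selfEnergy_zero], fun σ ω x₀ => by rw [sub_zero]; exact hT σ ω x₀⟩,
    ⟨0, fun _ _ _ _ => by simp only [selfEnergy_zero], fun σ ω x₀ => by rw [sub_zero]; exact hX σ ω x₀⟩⟩

/-- Budget monotonicity of the flow atom. -/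
theorem TwoLegSectorFlowMomentsAt.mono {Zt Zs Zt' Zs' β U μ : ℝ} {n : ℕ} (h : TwoLegSectorFlowMomentsAt L M Zt Zs β U μ n) (ht : Zt ≤ Zt')
    (hs : Zs ≤ Zs') : TwoLegSectorFlowMomentsAt L M Zt' Zs' β U μ n := by
  obtain ⟨bt, bs, h0, hZt, hZs, hincr⟩ := h
  exact ⟨bt, bs, h0, hZt.trans ht, hZs.trans hs, hincr⟩

/-- The budgets of the flow atom are nonnegative. -/
theorem TwoLegSectorFlowMomentsAt.budget_nonneg {Zt Zs β U μ : ℝ} {n : ℕ} (h : TwoLegSectorFlowMomentsAt L M Zt Zs β U μ n) : 0 ≤ Zt ∧ 0 ≤ Zs := by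
  obtain ⟨bt, bs, h0, hZt, hZs, _⟩ := h
  exact ⟨(sum_nonneg fun j hj => (h0 j (mem_range.1 hj)).1).trans hZt, (sum_nonneg fun j hj => (h0 j (mem_range.1 hj)).2).trans hZs⟩

/-! ## §2 The read-out point lies in the ball plateau of every increment's family -/

omit [NeZero L] [NeZero M] in
/-- **The deep-point inequality**: for `0 < β`, `3 ≤ n`, `π/β ≤ 4Λ_n` and `|e_K(k⃗)| ≤ Λ_n`, every `j` has `√((π/β)² + e_K(k⃗)²) ≤ Λ_{s_n(j)+1}`
(`(π/β)² + e² ≤ 17Λ_n² ≤ (16Λ_n)² = Λ_{n−2}²`, `Λ_{n−2} ≤ Λ_{s_n(j)+1}` by `klld_klScale_anti`). -/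
theorem sqrt_le_klScale_twoLegSectorScale {β μ : ℝ} (hβ : 0 < β) {K : TrigPolyC4v} {n : ℕ} (hn : 3 ≤ n) (hβn : Real.pi / β ≤ 4 * klScale klE0 n)
    {k : TorusSite 2 L} (hk : |nambuXiCT L μ K k| ≤ klScale klE0 n) (j : ℕ) :
    Real.sqrt ((Real.pi / β) ^ 2 + nambuXiCT L μ K k ^ 2) ≤ klScale klE0 (twoLegSectorScale n j + 1) := by
  have hΛ : 0 < klScale klE0 n := klth_klScale_pos n
  have hπ : 0 ≤ Real.pi / β := by positivity
  have h1 : (Real.pi / β) ^ 2 ≤ (4 * klScale klE0 n) ^ 2 := pow_le_pow_left₀ hπ hβn 2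
  have h2 : nambuXiCT L μ K k ^ 2 ≤ klScale klE0 n ^ 2 := by
    rw [← sq_abs]; exact pow_le_pow_left₀ (abs_nonneg _) hk 2
  have hsq : Real.sqrt ((Real.pi / β) ^ 2 + nambuXiCT L μ K k ^ 2) ≤ 16 * klScale klE0 n := by
    rw [Real.sqrt_le_left (by positivity)]
    nlinarith
  have hstep : klScale klE0 (n - 2) = 16 * klScale klE0 n := by
    obtain ⟨m, rfl⟩ : ∃ m, n = m + 2 := ⟨n - 2, by omega⟩
    rw [Nat.add_sub_cancel, show m + 2 = m + 1 + 1 from rfl, klth_klScale_succ, klth_klScale_succ]; ring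
  calc Real.sqrt ((Real.pi / β) ^ 2 + nambuXiCT L μ K k ^ 2) ≤ 16 * klScale klE0 n := hsq
    _ = klScale klE0 (n - 2) := hstep.symm
    _ ≤ klScale klE0 (twoLegSectorScale n j + 1) := klld_klScale_anti (twoLegSectorScale_succ_le hn)

-- The regime supplies the deep-point hypothesis at EVERY engine scale: `klte_pi_div_le_four_mul_klScale` (`…SplitThermalLayerExt`):
-- `klBetaMin ≤ β → n ≤ nScales β + 1 → π/β ≤ 4·Λ_n`.

/-! ## §3 The time row of class #7, closed on the consumer side -/

/-- **(E3d)/B1′ FROM THE SECTOR-PINNED ATOM**: `TwoLegSectorFlowMomentsAt L M Zt Zs β U μ n` with `3 ≤ n`, `0 < β`, `π/β ≤ 4Λ_n` gives, at every momentum of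
the scale-`n` shell of the flow frame, `|z_n(K_n)(k⃗) − 1| ≤ |z_0(K_n)(k⃗) − 1| + 4·Zt·U²` (the static corrections `S_j` drop out of `z` exactly).
[cite: BenfattoGiulianiMastropietro2006, (2.36), §3 (3.6)] -/
theorem abs_klFieldStrength_sub_one_le_of_twoLegSectorFlowMomentsAt {Zt Zs β U μ : ℝ} {n : ℕ} (hβ : 0 < β) (hn : 3 ≤ n)
    (hβn : Real.pi / β ≤ 4 * klScale klE0 n) (h : TwoLegSectorFlowMomentsAt L M Zt Zs β U μ n)
    {k : TorusSite 2 L} (hk : k ∈ klShell L μ (klFlowFrameU L M β U μ n) n) :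
    |klFieldStrength L M β U μ (klFlowFrameU L M β U μ n) n k - 1| ≤
      |klFieldStrength L M β U μ (klFlowFrameU L M β U μ n) 0 k - 1| + 4 * Zt * U ^ 2 := by
  obtain ⟨bt, bs, h0, hZt, _, hincr⟩ := h
  set K := klFlowFrameU L M β U μ n with hK
  have hk' : |nambuXiCT L μ K k| ≤ klScale klE0 n := by
    rw [klShell, mem_momentumShell] at hk; exact hk
  have hdeep : ∀ j < n, Real.sqrt ((Real.pi / β) ^ 2 + nambuXiCT L μ K k ^ 2) ≤ klScale klE0 (twoLegSectorScale n j + 1) :=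
    fun j _ => sqrt_le_klScale_twoLegSectorScale hβ hn hβn hk' j
  -- choose the static corrections increment by increment (zero beyond `n`)
  have hch : ∀ j, ∃ S : HubbardGrassmann L M, j < n →
      ((∀ (k : TorusSite 2 L) (σ : Fin 2), (selfEnergy L M β S (omega0 M, k) σ).im = (selfEnergy L M β S ((omega0 M).rev, k) σ).im) ∧
      ∀ (σ : Fin 2) (ω : Fin (sectorCount (twoLegSectorScale n j))) (x₀ : SpaceTimeIdx L M), imagTimeWeight β M *
        ∑ x ∈ (univ : Finset (Fin 2 → SpaceTimeIdx L M)).filter (fun x => x 0 = x₀), ∑ ω' : Fin (sectorCount (twoLegSectorScale n j)),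
          imagTimeWeight β M * (circDist (2 * M) (x 0).1.val (x 1).1.val : ℝ) *
            ‖sectorisedKernel L M β (klAnisoFamily L M β μ K klE0 (twoLegSectorScale n j))
                (klEffectiveAction L M β U μ K klE0 (j + 1) - klEffectiveAction L M β U μ K klE0 j - S) 2
                (![((ω, σ), 0), ((ω', σ), 1)] : Fin 2 → SectorLeg (sectorCount (twoLegSectorScale n j))) x‖ ≤ bt j * U ^ 2) := by
    intro j
    by_cases hj : j < n
    · obtain ⟨⟨S, hS, hT⟩, -⟩ := hincr j hj
      exact ⟨S, fun _ => ⟨hS, hT⟩⟩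
    · exact ⟨0, fun h => absurd h hj⟩
  choose S hS using hch
  -- the atom's time clause (leg 1 over ALL labels) dominates the telescope's hypothesis (leg 1 over the resolving labels)
  have hMt : ∀ j < n, ∀ (σ : Fin 2),
      ∀ ω ∈ univ.filter (fun ω : Fin (sectorCount (twoLegSectorScale n j)) =>
        klAnisoFamily L M β μ K klE0 (twoLegSectorScale n j) ω (omega0 M, k) ≠ 0),
      ∀ x₀ : SpaceTimeIdx L M, imagTimeWeight β M *
      ∑ x ∈ (univ : Finset (Fin 2 → SpaceTimeIdx L M)).filter (fun x => x 0 = x₀),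
        ∑ ω' ∈ univ.filter (fun ω : Fin (sectorCount (twoLegSectorScale n j)) =>
          klAnisoFamily L M β μ K klE0 (twoLegSectorScale n j) ω (omega0 M, k) ≠ 0),
        imagTimeWeight β M * (circDist (2 * M) (x 0).1.val (x 1).1.val : ℝ) *
          ‖sectorisedKernel L M β (klAnisoFamily L M β μ K klE0 (twoLegSectorScale n j))
              (klEffectiveAction L M β U μ K klE0 (j + 1) - klEffectiveAction L M β U μ K klE0 j - S j) 2
              (![((ω, σ), 0), ((ω', σ), 1)] : Fin 2 → SectorLeg (sectorCount (twoLegSectorScale n j))) x‖ ≤ bt j * U ^ 2 := by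
    intro j hj σ ω _ x₀
    refine le_trans (mul_le_mul_of_nonneg_left (sum_le_sum fun x _ => ?_) (imagTimeWeight_nonneg hβ.le M)) ((hS j hj).2 σ ω x₀)
    exact sum_le_sum_of_subset_of_nonneg (filter_subset _ _) fun ω' _ _ =>
      mul_nonneg (mul_nonneg (imagTimeWeight_nonneg hβ.le M) (Nat.cast_nonneg _)) (norm_nonneg _)
  have h := abs_klFieldStrength_sub_one_le_telescope_of_deep_uniform_static (L := L) (M := M) hβ U μ K k (twoLegSectorScale n) hdeep S
    (fun j hj σ => (hS j hj).1 k σ) (Mbar := fun j => bt j * U ^ 2) (fun j hj => mul_nonneg (h0 j hj).1 (sq_nonneg U)) hMt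
  have hsum : ∑ j ∈ range n, bt j * U ^ 2 ≤ Zt * U ^ 2 := by
    rw [← sum_mul]; exact mul_le_mul_of_nonneg_right hZt (sq_nonneg U)
  linarith

/-! ## §4 The space row as a Lipschitz bound on the shell, closed on the consumer side -/

omit [NeZero M] in
/-- The labels seeing either of two momenta: at most four. -/
theorem card_filter_klAnisoFamily_ne_zero_or_le_four (β μ : ℝ) (K : TrigPolyC4v) (e₀ : ℝ) (j : ℕ) (q q' : FreqMomentum L M) :
    (univ.filter (fun ω : Fin (sectorCount j) => klAnisoFamily L M β μ K e₀ j ω q ≠ 0 ∨ klAnisoFamily L M β μ K e₀ j ω q' ≠ 0)).card ≤ 4 := by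
  classical
  rw [filter_or]
  exact (card_union_le _ _).trans (by
    have h1 := card_filter_klAnisoFamily_ne_zero_le_two (L := L) (M := M) β μ K e₀ j q
    have h2 := card_filter_klAnisoFamily_ne_zero_le_two (L := L) (M := M) β μ K e₀ j q'
    omega)

/-- The union label set resolves the identity at a deep point (the extra labels contribute zero). -/
theorem sum_filter_or_klAnisoFamily_eq_one_of_le {β : ℝ} (μ : ℝ) (K : TrigPolyC4v) (j : ℕ) {k : TorusSite 2 L} (k' : TorusSite 2 L)
    (hdeep : Real.sqrt ((Real.pi / β) ^ 2 + nambuXiCT L μ K k ^ 2) ≤ klScale klE0 (j + 1)) :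
    ∑ ω ∈ univ.filter (fun ω : Fin (sectorCount j) => klAnisoFamily L M β μ K klE0 j ω (omega0 M, k) ≠ 0 ∨
        klAnisoFamily L M β μ K klE0 j ω (omega0 M, k') ≠ 0), klAnisoFamily L M β μ K klE0 j ω (omega0 M, k) = 1 := by
  classical
  rw [← sum_klAnisoFamily_omega0_eq_one_of_le (L := L) (M := M) β μ K j k hdeep]
  refine (sum_subset (filter_subset _ _) fun ω _ hω => ?_)
  rw [mem_filter, not_and_or] at hω
  rcases hω with h | h
  · exact absurd (mem_univ ω) h
  · push Not at h; exact h.1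

/-- **B2′ AS A SHELL-LIPSCHITZ BOUND FROM THE SECTOR-PINNED ATOM**: `TwoLegSectorFlowMomentsAt L M Zt Zs β U μ n` with `3 ≤ n`, `0 < β`, `π/β ≤ 4Λ_n` gives, for any
two momenta `p⃗, p⃗′` of the scale-`n` shell of the flow frame and each spin,
`‖Σ_n(ω₀,p⃗) − Σ_n(ω₀,p⃗′)‖ ≤ ‖Σ_0(ω₀,p⃗) − Σ_0(ω₀,p⃗′)‖ + 8·dist(p⃗,p⃗′)·Zs·U²`, `dist(p⃗,p⃗′) = (2π/L)·max_b|(p⃗−p⃗′)~_b|`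
(`Σ_m = selfEnergy` of `𝒱^{(m)}[K_n]`; the scale-`0` term is the frame base; the on-site corrections `S′_j` drop out exactly). [cite: BenfattoGiulianiMastropietro2006, (2.36), §3 (3.6)] -/
theorem norm_klSelfEnergy_sub_le_of_twoLegSectorFlowMomentsAt {Zt Zs β U μ : ℝ} {n : ℕ} (hβ : 0 < β) (hn : 3 ≤ n)
    (hβn : Real.pi / β ≤ 4 * klScale klE0 n) (h : TwoLegSectorFlowMomentsAt L M Zt Zs β U μ n) (σ : Fin 2)
    {p p' : TorusSite 2 L} (hp : p ∈ klShell L μ (klFlowFrameU L M β U μ n) n) (hp' : p' ∈ klShell L μ (klFlowFrameU L M β U μ n) n) :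
    ‖selfEnergy L M β (klEffectiveAction L M β U μ (klFlowFrameU L M β U μ n) klE0 n) (omega0 M, p) σ -
        selfEnergy L M β (klEffectiveAction L M β U μ (klFlowFrameU L M β U μ n) klE0 n) (omega0 M, p') σ‖ ≤
      ‖selfEnergy L M β (klEffectiveAction L M β U μ (klFlowFrameU L M β U μ n) klE0 0) (omega0 M, p) σ -
          selfEnergy L M β (klEffectiveAction L M β U μ (klFlowFrameU L M β U μ n) klE0 0) (omega0 M, p') σ‖ +
        8 * (2 * Real.pi / L * max |(((p - p') 0).valMinAbs : ℝ)| |(((p - p') 1).valMinAbs : ℝ)|) * Zs * U ^ 2 := by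
  classical
  obtain ⟨bt, bs, h0, _, hZs, hincr⟩ := h
  set K := klFlowFrameU L M β U μ n with hK
  set D : ℝ := 2 * Real.pi / L * max |(((p - p') 0).valMinAbs : ℝ)| |(((p - p') 1).valMinAbs : ℝ)| with hD
  have hD0 : 0 ≤ D := by rw [hD]; exact mul_nonneg (by positivity) (le_max_of_le_left (abs_nonneg _))
  have hkp : |nambuXiCT L μ K p| ≤ klScale klE0 n := by rw [klShell, mem_momentumShell] at hp; exact hp
  have hkp' : |nambuXiCT L μ K p'| ≤ klScale klE0 n := by rw [klShell, mem_momentumShell] at hp'; exact hp'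
  -- abbreviations: the scale-`m` self-energy difference and the per-increment bound
  set d : ℕ → ℂ := fun m => selfEnergy L M β (klEffectiveAction L M β U μ K klE0 m) (omega0 M, p) σ -
    selfEnergy L M β (klEffectiveAction L M β U μ K klE0 m) (omega0 M, p') σ with hd
  have hstep : ∀ j < n, ‖d (j + 1) - d j‖ ≤ 2 * D * (4 * (bs j * U ^ 2)) := by
    intro j hj
    obtain ⟨-, ⟨S', hS', hX⟩⟩ := hincr j hj
    set s := twoLegSectorScale n j with hs
    set A : Finset (Fin (sectorCount s)) := univ.filter (fun ω : Fin (sectorCount s) =>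
      klAnisoFamily L M β μ K klE0 s ω (omega0 M, p) ≠ 0 ∨ klAnisoFamily L M β μ K klE0 s ω (omega0 M, p') ≠ 0) with hA_def
    have hAp : ∑ ω ∈ A, klAnisoFamily L M β μ K klE0 s ω (omega0 M, p) = 1 :=
      sum_filter_or_klAnisoFamily_eq_one_of_le (L := L) (M := M) μ K s p' (sqrt_le_klScale_twoLegSectorScale hβ hn hβn hkp j)
    have hAp' : ∑ ω ∈ A, klAnisoFamily L M β μ K klE0 s ω (omega0 M, p') = 1 := by
      have h' := sum_filter_or_klAnisoFamily_eq_one_of_le (L := L) (M := M) μ K s p (sqrt_le_klScale_twoLegSectorScale hβ hn hβn hkp' j)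
      rw [hA_def]
      convert h' using 2
      ext ω
      simp only [mem_filter, mem_univ, true_and]
      exact or_comm
    have hcard : (A.card : ℝ) ≤ 4 := by exact_mod_cast card_filter_klAnisoFamily_ne_zero_or_le_four (L := L) (M := M) β μ K klE0 s (omega0 M, p) (omega0 M, p')
    -- the atom's space clause (leg 1 over all labels) dominates the Lipschitz lemma's hypothesis (leg 1 over `A`)
    have hMs : ∀ ω ∈ A, ∀ x₀ : SpaceTimeIdx L M, imagTimeWeight β M *
        ∑ x ∈ (univ : Finset (Fin 2 → SpaceTimeIdx L M)).filter (fun x => x 0 = x₀), ∑ ω' ∈ A,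
          (|((((x 0).2 - (x 1).2) 0).valMinAbs : ℝ)| + |((((x 0).2 - (x 1).2) 1).valMinAbs : ℝ)|) *
            ‖sectorisedKernel L M β (klAnisoFamily L M β μ K klE0 s)
                (klEffectiveAction L M β U μ K klE0 (j + 1) - klEffectiveAction L M β U μ K klE0 j - S') 2
                (![((ω, σ), 0), ((ω', σ), 1)] : Fin 2 → SectorLeg (sectorCount s)) x‖ ≤ bs j * U ^ 2 := by
      intro ω _ x₀
      refine le_trans (mul_le_mul_of_nonneg_left (sum_le_sum fun x _ => ?_) (imagTimeWeight_nonneg hβ.le M)) (hX σ ω x₀)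
      exact sum_le_sum_of_subset_of_nonneg (filter_subset _ _) fun ω' _ _ => mul_nonneg (by positivity) (norm_nonneg _)
    have hL := norm_selfEnergy_increment_sub_le_of_sector_space_moment_static (L := L) (M := M) hβ (klAnisoFamily L M β μ K klE0 s)
      (klEffectiveAction L M β U μ K klE0 (j + 1)) (klEffectiveAction L M β U μ K klE0 j) S' (omega0 M) p p' σ (hS' (omega0 M) σ p p') hAp hAp'
      (Ms := fun _ => bs j * U ^ 2) hMs
    have hsumA : ∑ _ω ∈ A, bs j * U ^ 2 ≤ 4 * (bs j * U ^ 2) := by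
      rw [sum_const, nsmul_eq_mul]
      exact mul_le_mul_of_nonneg_right hcard (mul_nonneg (h0 j hj).2 (sq_nonneg U))
    have heq : d (j + 1) - d j = (selfEnergy L M β (klEffectiveAction L M β U μ K klE0 (j + 1)) (omega0 M, p) σ -
          selfEnergy L M β (klEffectiveAction L M β U μ K klE0 j) (omega0 M, p) σ) -
        (selfEnergy L M β (klEffectiveAction L M β U μ K klE0 (j + 1)) (omega0 M, p') σ -
          selfEnergy L M β (klEffectiveAction L M β U μ K klE0 j) (omega0 M, p') σ) := by rw [hd]; ring
    rw [heq]
    exact hL.trans (by rw [← hD]; exact mul_le_mul_of_nonneg_left hsumA (by positivity))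
  -- telescope
  have htel : d n = d 0 + ∑ j ∈ range n, (d (j + 1) - d j) := by rw [sum_range_sub]; ring
  have hnorm : ‖d n‖ ≤ ‖d 0‖ + ∑ j ∈ range n, ‖d (j + 1) - d j‖ := by
    rw [htel]; exact (norm_add_le _ _).trans (add_le_add le_rfl (norm_sum_le _ _))
  have hsum : ∑ j ∈ range n, ‖d (j + 1) - d j‖ ≤ 8 * D * Zs * U ^ 2 := by
    calc ∑ j ∈ range n, ‖d (j + 1) - d j‖ ≤ ∑ j ∈ range n, 2 * D * (4 * (bs j * U ^ 2)) :=
          sum_le_sum fun j hj => hstep j (mem_range.1 hj)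
      _ = 8 * D * U ^ 2 * ∑ j ∈ range n, bs j := by rw [mul_sum]; exact sum_congr rfl fun j _ => by ring
      _ ≤ 8 * D * U ^ 2 * Zs := mul_le_mul_of_nonneg_left hZs (by positivity)
      _ = 8 * D * Zs * U ^ 2 := by ring
  have hfin := hnorm.trans (add_le_add le_rfl hsum)
  simpa only [hd, hD] using hfin

/-! ## §5 The supplier door: the increment atom from the tower's weighted sector-pinned carrier -/

/-- **THE INCREMENT ATOM FROM THE TOWER'S CARRIER** (`0 ≤ β`): if, for corrections `S` (symmetric `Im Σ̂_S(±ω₀,·)`) and `S′` (`Σ̂_{S′}(ν,·)` momentum-independent),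
the rate-`r` weighted sector-pinned sums of the scale-`s` analysed two-leg kernels satisfy, for every spin, pinned sector and pinned point,
`klWtPinnedSumAt L M β μ K s r 2 (𝒱^{(j+1)}[K] − 𝒱^{(j)}[K] − S) 0 (x₀,((ω,σ),+)) ≤ b·U²` and `… (… − S′) … ≤ b′·U²`, then
`TwoLegSectorIncrementAt L M (Λ_r⁻¹·b) (2Λ_r⁻¹·b′) β U μ K s j` (`EngineV8.sectorTimeMoment_le_of_klWtPinnedSumAt` / `…SpaceMoment…`).
[cite: BenfattoGiulianiMastropietro2006, §3 (3.5)-(3.6)] -/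
theorem twoLegSectorIncrementAt_of_klWtPinnedSumAt {β U μ : ℝ} (hβ : 0 ≤ β) {K : TrigPolyC4v} {s r j : ℕ} {b b' : ℝ}
    (S S' : HubbardGrassmann L M)
    (hS : ∀ (k : TorusSite 2 L) (σ : Fin 2), (selfEnergy L M β S (omega0 M, k) σ).im = (selfEnergy L M β S ((omega0 M).rev, k) σ).im)
    (hS' : ∀ (ν : MatsubaraIdx M) (σ : Fin 2) (p p' : TorusSite 2 L), selfEnergy L M β S' (ν, p) σ = selfEnergy L M β S' (ν, p') σ)
    (hb : ∀ (σ : Fin 2) (ω : Fin (sectorCount s)) (x₀ : SpaceTimeIdx L M),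
      EngineV8.klWtPinnedSumAt L M β μ K s r 2 (klEffectiveAction L M β U μ K klE0 (j + 1) - klEffectiveAction L M β U μ K klE0 j - S) 0
        (x₀, ((ω, σ), 0)) ≤ b * U ^ 2)
    (hb' : ∀ (σ : Fin 2) (ω : Fin (sectorCount s)) (x₀ : SpaceTimeIdx L M),
      EngineV8.klWtPinnedSumAt L M β μ K s r 2 (klEffectiveAction L M β U μ K klE0 (j + 1) - klEffectiveAction L M β U μ K klE0 j - S') 0
        (x₀, ((ω, σ), 0)) ≤ b' * U ^ 2) :
    TwoLegSectorIncrementAt L M ((klScale klE0 r)⁻¹ * b) (2 * (klScale klE0 r)⁻¹ * b') β U μ K s j := by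
  refine ⟨⟨S, hS, fun σ ω x₀ => ?_⟩, ⟨S', hS', fun σ ω x₀ => ?_⟩⟩
  · have h := EngineV8.sectorTimeMoment_le_of_klWtPinnedSumAt (L := L) (M := M) hβ (hb σ ω x₀)
    simpa only [mul_assoc] using h
  · have h := EngineV8.sectorSpaceMoment_le_of_klWtPinnedSumAt (L := L) (M := M) hβ (hb' σ ω x₀)
    simpa only [mul_assoc] using h

end Model

end Summit.HubbardSuperconductivity.HubbardSuperconductivity.Theorems.KLRegimeSplit

end
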